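import Summits.QuantumFields.QCD.Theses.NestedDissectionSea

/-!
# Line `mass-wegner-cell-index` — crux `NegativeCellsDilute` (stmt-QuantumFields-13900) — LEAD'S SKELETON

Reshaped by the line lead (prover-line-stmt-QuantumFields-13900-0, 2026-08-16) from the planner's checked
skeleton `Cruxes/NegativeCellsDilute/Lines/mass-wegner-cell-index.lean` (planner-cruxplan-…-mass-wegner-cell-ind-0):
the planner's stub 1 `stub_reverseWegnerSojourn` (SOJOURN OF A DEFECT) is split at the skeleton level into its three
mathematically independent ingredients, each a registered stub over TREE VOCABULARY ONLY,

* `stub_defectCrossing` — a sign defect forces a zero mode of the parent or a child cell at a bare mass `μ₀ ≥ μ`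
  (= route support `SignDefectForcesCrossing`, stmt-13898, verbatim body; real monic polynomial + IVT);
* `stub_kineticEdgeCell` — KINETIC EDGE of a Dirichlet cell: `det wilsonCell U μ' x s = 0`, `s_i ≤ N` ⇒
  `Σ_i (1 − cos(π/s_i)) ≤ −μ'` (= route support `KineticEdge` clause (a), stmt-13899; numerical range
  `Re⟨ψ,D(0)ψ⟩ = ½Σ‖∇^Uψ‖²` (landed `…TipNoBindingStubPositivity`) + Kato (landed `…StubDiamagnetic`) + the Dirichlet
  ground-state bound of the open box by the positive supersolution `Π_i sin(π t_i/s_i)`);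
* `stub_sojourn` — the bare mass is a scalar shift of every cell matrix: a kernel vector at `μ₀` is an exact
  eigenvector with eigenvalue `μ' − μ₀` at every `μ'`;

and the planner's stub-1 statement is now the sorry-free glue theorem `reverseWegnerSojourn` below. Stubs 2 and 3 are
kept verbatim (`stub_reverseWegnerCount`, `stub_pinnedStripLaw`). Registered stubs: 5 ≤ stubs_max. The composition
`NegativeCellsDilute_of` is the planner's, unchanged, and concludes the crux BY NAME.

## Architecture (planner's text, abridged)

Notation: for a corner-`0` box `s`, `edge(s) = Σ_i (1 − cos(π/s_i))`; `near_η(U, μ′)` = the box or one of its sixteen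
children has a non-zero `v` with `Σ_p ‖(wilsonCell U μ′ · ·) v p‖² < η² Σ_p ‖v p‖²`; `P` = the crux's phase-quenched
probability VERBATIM; the STRIP STATISTIC of the box is `η⁻¹ Σ_f ∫_{μ′ ∈ [m_f, η − edge(s)]} P(near_η(·, μ′)) dμ′`.
`reverseWegnerSojourn` (from stubs 1a–1c): a defect at `μ` gives a crossing `μ₀ ∈ [μ, −edge(s)]` of parent/child whose
kernel vector is an `η`-near kernel at every `μ′` within `η` of `μ₀`. `stub_reverseWegnerCount`: any event forcing
such a sojourn has `P ≤` strip statistic (Tonelli over the open near-kernel event). `stub_pinnedStripLaw` (OPEN): the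
windowed strip law (a⁺) AND the parity pin (b) under ONE `reg`. `NegativeCellsDilute_of`: pure logic.

## Disproof used (`Cruxes/NegativeCellsDilute/Disproof.lean` v5, NO KILL, no `_false_without_` theorem)
§ 2/§ 4 (`withoutPin_holds`, `crux_of_highLinePin`, landed CellPositivity): (a) and (a⁺) alone are junk-true along a
high line, so the pin rides in `stub_pinnedStripLaw` under the same `∃ reg` (honoured). § 1/§ 5 (PinWindow,
UniformPinFalse): the pin forces the probe into `[−8,0]` and `limsup mcrit ≤ 0`; consistent with the strips. § 6
`signDefectForcesCrossing`: is exactly `stub_defectCrossing` (the worker re-lands it under Theorems/ over the landed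
CellPositivity lemmas). No `-- Targets` section names a stub of this line yet.
-/

noncomputable section

namespace Summit.QuantumFields.QCD.Cruxes.NegativeCellsDilute.MassWegnerCellIndex

open scoped BigOperators ENNReal Classical
open MeasureTheory Filter
open Literature.MathematicalPhysics.QuantumLattice Literature.MathematicalPhysics.QuantumFieldTheory
  Literature.Probability.LatticeModels
open Summit.QuantumFields.QCD.Theses.NestedDissectionSea (NegativeCellsDilute)

/-! ## Registered stubs (`sorry` lives only here; signatures over tree vocabulary only) -/

/-- **Stub 1a — `defectCrossing` (a sign defect forces a crossing at or above the mass; provable now, size S).**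
Verbatim the body of route support `SignDefectForcesCrossing` (stmt-QuantumFields-13898): if the corner-`0` box of
sides `s` is a sign defect at bare mass `μ` and scale `j`, some cell among {parent, 16 children} has `det = 0` at a bare
mass `μ₀ ≥ μ`. Proof (disprover's `Disproof.lean` § 6): each `t ↦ det wilsonCell U t x s'` is real
(`NegativeCellsDiluteCellPositivity.block_det_im`, landed), continuous (affine in `t`), positive at `t = 1`
(`block_det_re_pos`, landed); a negative leaf determinant or a negative 17-fold product has a negative factor; IVT. -/
theorem stub_defectCrossing :
    ∀ (N : ℕ) [NeZero N] (U : GaugeConfig 4 N (Matrix.specialUnitaryGroup (Fin 3) ℂ)) (μ : ℝ) (j : ℕ)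
      (s : Fin 4 → ℕ), IsSignDefect U μ j s →
      ∃ μ₀ : ℝ, μ ≤ μ₀ ∧ ((wilsonCell U μ₀ 0 s).det = 0 ∨
        ∃ c : Fin 4 → Bool, (wilsonCell U μ₀ (halfCorner s c) (halfSides s c)).det = 0) := by
  sorry

/-- **Stub 1b — `kineticEdgeCell` (KINETIC EDGE of a Dirichlet Wilson cell; provable now, size M–L).**
Clause (a) of route support `KineticEdge` (stmt-QuantumFields-13899), one cell at a time: if the Dirichlet cell of
corner `x` and sides `s ≤ N` has a zero mode at bare mass `μ'`, then `Σ_i (1 − cos(π/s_i)) ≤ −μ'`. Proof: a kernel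
vector `v ≠ 0` of the cell, zero-extended to `ψ` on the torus (`block_form_eq_extend`, landed CellPositivity), has
`0 = Re⟨ψ, D(μ')ψ⟩ = μ'‖ψ‖² + ½ Σ_{y,ν} ‖U(y,ν)ψ(y+ν̂) − ψ(y)‖²` (landed `TipNoBindingStubPositivity.stub_positivity` at
mass `0` + `D(t) = D(0) + t·1`); Kato (landed `TipNoBindingStubDiamagnetic.stub_diamagnetic`) bounds the kinetic term
below by the lattice Dirichlet energy `½ Σ_{y,ν} (f(y+ν̂) − f(y))²` of the site modulus `f = |ψ|`, supported in the
open box; and for such `f`, `Σ_{y,ν} f(y)f(y+ν̂) ≤ (Σ_i cos(π/s_i)) Σ_y f(y)²` by the AM–GM ground-state substitution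
with the positive supersolution `Φ(y) = Π_i sin(π t_i(y)/s_i)` (`t_i` the offset from the corner; `Φ = 0` on the
bounding sheets, `Φ(y+ν̂) + Φ(y−ν̂) = 2cos(π/s_ν)Φ(y)` inside), whence `−μ'‖f‖² ≥ (4 − Σ cos(π/s_i))‖f‖²`. -/
theorem stub_kineticEdgeCell :
    ∀ (N : ℕ) [NeZero N] (U : GaugeConfig 4 N (Matrix.specialUnitaryGroup (Fin 3) ℂ)) (μ' : ℝ)
      (x : TorusSite 4 N) (s : Fin 4 → ℕ), (∀ i, s i ≤ N) → (wilsonCell U μ' x s).det = 0 →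
      ∑ i, (1 - Real.cos (Real.pi / s i)) ≤ -μ' := by
  sorry

/-- **Stub 1c — `sojourn` (the bare mass is a scalar shift of every cell; provable now, size S).**
If `v` is a kernel vector of the Dirichlet cell `(x, s)` at bare mass `μ₀`, then at every bare mass `μ'` it is an
exact eigenvector with eigenvalue `μ' − μ₀`: `wilsonCell U μ' x s *ᵥ v = (μ' − μ₀) • v`. Proof:
`wilsonDirac ρ U μ' 1 = wilsonDirac ρ U μ₀ 1 + (μ' − μ₀)•1` (`wilsonDirac_eq_sub_sum_wilsonHop`), and restriction to a
principal block commutes with `+ c•1` (`toSquareBlockProp_one/_smul`, landed CellPositivity). -/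
theorem stub_sojourn :
    ∀ (N : ℕ) [NeZero N] (U : GaugeConfig 4 N (Matrix.specialUnitaryGroup (Fin 3) ℂ)) (μ₀ μ' : ℝ)
      (x : TorusSite 4 N) (s : Fin 4 → ℕ) (v : {p // wilsonBox x s p} → ℂ),
      (wilsonCell U μ₀ x s).mulVec v = 0 →
      (wilsonCell U μ' x s).mulVec v = ((μ' - μ₀ : ℝ) : ℂ) • v := by
  sorry

/-- **Stub 2 — `reverseWegnerCount` (REVERSE WEGNER COUNTING; measure theory, provable now, size M–L).**
(Planner's stub 2, verbatim.) For every torus side `N`, coupling `β`, flavour number `Nf`, valence masses `mq`,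
corner-`0` box `s` and tolerance `η > 0`: ANY event `E` on gauge fields which forces, for some flavour `f`, a
crossing-type sojourn — a mass `μ₀ ∈ [mq f, −edge(s)]` with `near_η(U, μ′)` at every `μ′` within `η` of `μ₀` — has
phase-quenched probability at most the strip statistic `η⁻¹ Σ_f ∫_{μ′ ∈ [mq f, η − edge(s)]} P(near_η(·, μ′)) dμ′`.
Proof route: pointwise `1_E(U) ≤ η⁻¹ Σ_f Leb{μ′ ∈ [mq f, η − edge] : near_η(U, μ′)}` (the half-sojourn
`[μ₀, μ₀ + η)` lies in the strip because `mq f ≤ μ₀ ≤ −edge`); multiply by the weight `≥ 0`, integrate, Tonelli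
(`MeasureTheory.lintegral_lintegral_swap`; `{(μ′, U) | near_η(U, μ′)}` is OPEN — strict inequality, continuous in
`(μ′, U)` for fixed `v` (`continuous_wilsonDirac`, `continuous_fundamentalRep`), union over `v` — hence measurable:
`IsOpen.measurableSet`); divide by the normaliser (`= 0` ⇒ both sides `0`; else `> 0`); a non-integrable `1_E · wt`
makes the left side the junk value `0 ≤` right side. -/
theorem stub_reverseWegnerCount :
    ∀ (N : ℕ) [NeZero N] (β : ℝ) (Nf : ℕ) (mq : Fin Nf → ℝ) (s : Fin 4 → ℕ) (η : ℝ), 0 < η →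
      ∀ E : GaugeConfig 4 N (Matrix.specialUnitaryGroup (Fin 3) ℂ) → Prop,
        (∀ U, E U → ∃ f : Fin Nf, ∃ μ₀ : ℝ, mq f ≤ μ₀ ∧ μ₀ ≤ -∑ i, (1 - Real.cos (Real.pi / s i)) ∧
            ∀ μ' : ℝ, |μ' - μ₀| < η →
              ((∃ v : {p // wilsonBox (0 : TorusSite 4 N) s p} → ℂ, v ≠ 0 ∧
                  ∑ p, ‖(wilsonCell U μ' 0 s).mulVec v p‖ ^ 2 < η ^ 2 * ∑ p, ‖v p‖ ^ 2) ∨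
                ∃ c : Fin 4 → Bool, ∃ v : {p // wilsonBox (halfCorner s c : TorusSite 4 N) (halfSides s c) p} → ℂ,
                  v ≠ 0 ∧ ∑ p, ‖(wilsonCell U μ' (halfCorner s c) (halfSides s c)).mulVec v p‖ ^ 2 <
                    η ^ 2 * ∑ p, ‖v p‖ ^ 2)) →
        (∫ U : GaugeConfig 4 N (Matrix.specialUnitaryGroup (Fin 3) ℂ), (if E U then (1 : ℝ) else 0) *
              ∏ f, ‖fermionDet (wilsonDirac (fundamentalRep (Fin 3)) U (mq f) 1)‖ ∂(wilsonMeasure (fundamentalRep (Fin 3)) β)) /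
          (∫ U : GaugeConfig 4 N (Matrix.specialUnitaryGroup (Fin 3) ℂ),
              ∏ f, ‖fermionDet (wilsonDirac (fundamentalRep (Fin 3)) U (mq f) 1)‖ ∂(wilsonMeasure (fundamentalRep (Fin 3)) β)) ≤
          η⁻¹ * ∑ f, (∫⁻ μ' in Set.Icc (mq f) (η - ∑ i, (1 - Real.cos (Real.pi / s i))),
            ENNReal.ofReal
              ((∫ U : GaugeConfig 4 N (Matrix.specialUnitaryGroup (Fin 3) ℂ), (if ((∃ v : {p // wilsonBox (0 : TorusSite 4 N) s p} → ℂ, v ≠ 0 ∧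
                    ∑ p, ‖(wilsonCell U μ' 0 s).mulVec v p‖ ^ 2 < η ^ 2 * ∑ p, ‖v p‖ ^ 2) ∨
                  ∃ c : Fin 4 → Bool, ∃ v : {p // wilsonBox (halfCorner s c : TorusSite 4 N) (halfSides s c) p} → ℂ,
                    v ≠ 0 ∧ ∑ p, ‖(wilsonCell U μ' (halfCorner s c) (halfSides s c)).mulVec v p‖ ^ 2 <
                      η ^ 2 * ∑ p, ‖v p‖ ^ 2) then (1 : ℝ) else 0) *
                    ∏ f, ‖fermionDet (wilsonDirac (fundamentalRep (Fin 3)) U (mq f) 1)‖ ∂(wilsonMeasure (fundamentalRep (Fin 3)) β)) /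
                (∫ U : GaugeConfig 4 N (Matrix.specialUnitaryGroup (Fin 3) ℂ),
                    ∏ f, ‖fermionDet (wilsonDirac (fundamentalRep (Fin 3)) U (mq f) 1)‖ ∂(wilsonMeasure (fundamentalRep (Fin 3)) β)))).toReal := by
  sorry

/-- **Stub 3 — `pinnedStripLaw` (THE TRANSFER `C⁺`; open, size XL, the hardest stub; held by the lead).**
(Planner's stub 3, verbatim.) Same prefix as the crux: for `N_f ∈ {2,3}` ONE mass-independent regularisation `reg`
(`HasMassScaling`, `HasAsymptoticScaling`), `M₀ ≥ 0`, leaf size `b₀ ≥ 2`, physical window `ℓ > 0`, such that every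
mass tuple `m > M₀` has a physical size `R > 0` with
(a⁺) WINDOWED STRIP LAW — for every `ε > 0`, eventually in `k`, on every odd torus `(ℤ/(2S+1))⁴` of physical side
`≥ R`, there are a tolerance `η > 0` and `δ ≥ 0` with `Σ_{j<J} δ_j ≤ ε`, `J = log₂(⌊ℓ/a_k⌋/b₀) + 1`, such that for
every corner-`0` box `s` with sides in `[b₀2^j, b₀2^{j+2})`, `s_i ≤ 2S+1`, `s_i a_k ≤ ℓ`:
`η⁻¹ Σ_f ∫_{[m_f(k), η − edge(s)]} P_k(near_η(·, μ′)) dμ′ ≤ δ_j`, `m_f(k) = mcrit k + a_k m_f / Z_m k`; AND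
(b) PARITY PIN — VERBATIM the second conjunct of the crux, under the SAME `reg`. -/
theorem stub_pinnedStripLaw :
    ∀ Nf : ℕ, (Nf = 2 ∨ Nf = 3) → ∃ reg : QCDRegularisation Nf, reg.HasMassScaling ∧
      (reg.scheme 0 0 0).HasAsymptoticScaling ∧ ∃ M₀ : ℝ, 0 ≤ M₀ ∧ ∃ b₀ : ℕ, 2 ≤ b₀ ∧ ∃ ℓ : ℝ, 0 < ℓ ∧
      ∀ m : Fin Nf → ℝ, (∀ f, M₀ < m f) → ∃ R : ℝ, 0 < R ∧
      (∀ ε : ℝ, 0 < ε → ∀ᶠ k : ℕ in Filter.atTop, ∀ S : ℕ, R ≤ reg.a k * (2 * S + 1) →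
        ∃ η : ℝ, 0 < η ∧ ∃ δ : ℕ → ℝ, (∀ j, 0 ≤ δ j) ∧
          ∑ j ∈ Finset.range (Nat.log 2 (⌊ℓ / reg.a k⌋₊ / b₀) + 1), δ j ≤ ε ∧
          ∀ j < Nat.log 2 (⌊ℓ / reg.a k⌋₊ / b₀) + 1, ∀ s : Fin 4 → ℕ,
            (∀ i, b₀ * 2 ^ j ≤ s i ∧ s i < b₀ * 2 ^ (j + 2) ∧ s i ≤ 2 * S + 1 ∧ (s i : ℝ) * reg.a k ≤ ℓ) →
            η⁻¹ * ∑ f, (∫⁻ μ' in Set.Icc (reg.mcrit k + reg.a k * m f / reg.Zm k) (η - ∑ i, (1 - Real.cos (Real.pi / s i))),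
              ENNReal.ofReal
                ((∫ U : GaugeConfig 4 (2 * S + 1) (Matrix.specialUnitaryGroup (Fin 3) ℂ), (if ((∃ v : {p // wilsonBox (0 : TorusSite 4 (2 * S + 1)) s p} → ℂ, v ≠ 0 ∧
                      ∑ p, ‖(wilsonCell U μ' 0 s).mulVec v p‖ ^ 2 < η ^ 2 * ∑ p, ‖v p‖ ^ 2) ∨
                    ∃ c : Fin 4 → Bool, ∃ v : {p // wilsonBox (halfCorner s c : TorusSite 4 (2 * S + 1)) (halfSides s c) p} → ℂ,
                      v ≠ 0 ∧ ∑ p, ‖(wilsonCell U μ' (halfCorner s c) (halfSides s c)).mulVec v p‖ ^ 2 <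
                        η ^ 2 * ∑ p, ‖v p‖ ^ 2) then (1 : ℝ) else 0) *
                      ∏ f, ‖fermionDet (wilsonDirac (fundamentalRep (Fin 3)) U (reg.mcrit k + reg.a k * m f / reg.Zm k) 1)‖ ∂(wilsonMeasure (fundamentalRep (Fin 3)) (reg.β k))) /
                  (∫ U : GaugeConfig 4 (2 * S + 1) (Matrix.specialUnitaryGroup (Fin 3) ℂ),
                      ∏ f, ‖fermionDet (wilsonDirac (fundamentalRep (Fin 3)) U (reg.mcrit k + reg.a k * m f / reg.Zm k) 1)‖ ∂(wilsonMeasure (fundamentalRep (Fin 3)) (reg.β k))))).toReal ≤ δ j) ∧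
      (∀ M : ℝ, M₀ < M → ∀ᶠ k : ℕ in Filter.atTop, ∀ S : ℕ, R ≤ reg.a k * (2 * S + 1) →
        (1 / 4 : ℝ) ≤
          (∫ U : GaugeConfig 4 (2 * S + 1) (Matrix.specialUnitaryGroup (Fin 3) ℂ), (if (fermionDet (wilsonDirac (fundamentalRep (Fin 3)) U (reg.mcrit k - reg.a k * M / reg.Zm k) 1)).re < 0 then (1 : ℝ) else 0) *
                ∏ f, ‖fermionDet (wilsonDirac (fundamentalRep (Fin 3)) U (reg.mcrit k + reg.a k * m f / reg.Zm k) 1)‖ ∂(wilsonMeasure (fundamentalRep (Fin 3)) (reg.β k))) /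
            (∫ U : GaugeConfig 4 (2 * S + 1) (Matrix.specialUnitaryGroup (Fin 3) ℂ),
                ∏ f, ‖fermionDet (wilsonDirac (fundamentalRep (Fin 3)) U (reg.mcrit k + reg.a k * m f / reg.Zm k) 1)‖ ∂(wilsonMeasure (fundamentalRep (Fin 3)) (reg.β k)))) := by
  sorry

/-! ## Glue (PROVED, no `sorry`): the planner's stub 1 from stubs 1a–1c -/

/-- Each child side is at least `1` when the parent sides are `≥ 2`. -/
theorem one_le_halfSides (s : Fin 4 → ℕ) (hs : ∀ i, 2 ≤ s i) (c : Fin 4 → Bool) (i : Fin 4) :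
    1 ≤ halfSides s c i := by
  have h := hs i
  unfold halfSides
  split_ifs <;> omega

/-- Monotonicity of the kinetic edge in the sides: shrinking a box (to sides `≥ 1`) raises its edge,
`Σ_i (1 − cos(π/s_i)) ≤ Σ_i (1 − cos(π/s'_i))` for `1 ≤ s'_i ≤ s_i`. -/
theorem edge_mono {s s' : Fin 4 → ℕ} (h1 : ∀ i, 1 ≤ s' i) (hle : ∀ i, s' i ≤ s i) :
    ∑ i, (1 - Real.cos (Real.pi / s i)) ≤ ∑ i, (1 - Real.cos (Real.pi / s' i)) := by
  refine Finset.sum_le_sum fun i _ => ?_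
  have hs'pos : (0 : ℝ) < s' i := by exact_mod_cast h1 i
  have hspos : (0 : ℝ) < s i := by exact_mod_cast lt_of_lt_of_le (h1 i) (hle i)
  have hle' : (s' i : ℝ) ≤ s i := by exact_mod_cast hle i
  have hcos : Real.cos (Real.pi / s' i) ≤ Real.cos (Real.pi / s i) := by
    apply Real.cos_le_cos_of_nonneg_of_le_pi
    · positivity
    · rw [div_le_iff₀ hs'pos]
      have : (1 : ℝ) ≤ s' i := by exact_mod_cast h1 i
      nlinarith [Real.pi_pos]
    · exact div_le_div_of_nonneg_left Real.pi_pos.le hs'pos hle'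
  linarith

/-- An exact eigenvector with eigenvalue `μ' − μ₀`, `|μ' − μ₀| < η`, is an `η`-near-kernel vector. -/
theorem near_of_eigen {ι : Type*} [Fintype ι] {v w : ι → ℂ} (hv : v ≠ 0) {μ₀ μ' η : ℝ}
    (hw : w = ((μ' - μ₀ : ℝ) : ℂ) • v) (hη : |μ' - μ₀| < η) :
    ∑ p, ‖w p‖ ^ 2 < η ^ 2 * ∑ p, ‖v p‖ ^ 2 := by
  have hsum : ∑ p, ‖w p‖ ^ 2 = |μ' - μ₀| ^ 2 * ∑ p, ‖v p‖ ^ 2 := by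
    rw [Finset.mul_sum]
    refine Finset.sum_congr rfl fun p _ => ?_
    rw [hw, Pi.smul_apply, smul_eq_mul, norm_mul, Complex.norm_real, Real.norm_eq_abs]
    ring
  have hpos : 0 < ∑ p, ‖v p‖ ^ 2 := by
    obtain ⟨p, hp⟩ : ∃ p, v p ≠ 0 := Function.ne_iff.mp hv
    exact Finset.sum_pos' (fun q _ => by positivity) ⟨p, Finset.mem_univ _, by positivity⟩
  have habs : 0 ≤ |μ' - μ₀| := abs_nonneg _
  have hsq : |μ' - μ₀| ^ 2 < η ^ 2 := by
    have hη0 : 0 < η := lt_of_le_of_lt habs hη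
    nlinarith
  rw [hsum]
  exact mul_lt_mul_of_pos_right hsq hpos

/-- **The planner's stub 1 (`reverseWegnerSojourn`), now a theorem from stubs 1a–1c.** A sign defect of the box `s`
(`2 ≤ s_i ≤ N`) at scale `j` and valence mass `μ` forces a crossing mass `μ₀ ∈ [μ, −edge(s)]` of the parent or of a
child such that for every `η` and every `μ'` with `|μ' − μ₀| < η` THAT cell has an `η`-near-kernel (its kernel vector
at `μ₀`). -/
theorem reverseWegnerSojourn :
    ∀ (N : ℕ) [NeZero N] (U : GaugeConfig 4 N (Matrix.specialUnitaryGroup (Fin 3) ℂ)) (μ : ℝ) (j : ℕ)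
      (s : Fin 4 → ℕ), (∀ i, 2 ≤ s i) → (∀ i, s i ≤ N) → IsSignDefect U μ j s →
      ∃ μ₀ : ℝ, μ ≤ μ₀ ∧ μ₀ ≤ -∑ i, (1 - Real.cos (Real.pi / s i)) ∧
        ∀ η μ' : ℝ, |μ' - μ₀| < η →
          ((∃ v : {p // wilsonBox (0 : TorusSite 4 N) s p} → ℂ, v ≠ 0 ∧
              ∑ p, ‖(wilsonCell U μ' 0 s).mulVec v p‖ ^ 2 < η ^ 2 * ∑ p, ‖v p‖ ^ 2) ∨
            ∃ c : Fin 4 → Bool, ∃ v : {p // wilsonBox (halfCorner s c : TorusSite 4 N) (halfSides s c) p} → ℂ,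
              v ≠ 0 ∧ ∑ p, ‖(wilsonCell U μ' (halfCorner s c) (halfSides s c)).mulVec v p‖ ^ 2 <
                η ^ 2 * ∑ p, ‖v p‖ ^ 2) := by
  intro N _ U μ j s hs2 hsN hdef
  obtain ⟨μ₀, hμ, hcross⟩ := stub_defectCrossing N U μ j s hdef
  have hs1 : ∀ i, 1 ≤ s i := fun i => le_trans (by norm_num) (hs2 i)
  rcases hcross with hpar | ⟨c, hch⟩
  · -- the parent crosses at μ₀
    have hedge := stub_kineticEdgeCell N U μ₀ 0 s hsN hpar
    obtain ⟨v, hv, hker⟩ := Matrix.exists_mulVec_eq_zero_iff.mpr hpar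
    refine ⟨μ₀, hμ, by linarith, fun η μ' hη => Or.inl ⟨v, hv, ?_⟩⟩
    exact near_of_eigen hv (stub_sojourn N U μ₀ μ' 0 s v hker) hη
  · -- the child `c` crosses at μ₀
    have hsN' : ∀ i, halfSides s c i ≤ N := fun i => le_trans (halfSides_le s c i) (hsN i)
    have hedge := stub_kineticEdgeCell N U μ₀ (halfCorner s c) (halfSides s c) hsN' hch
    have hmono := edge_mono (s := s) (s' := halfSides s c) (one_le_halfSides s hs2 c) (halfSides_le s c)
    obtain ⟨v, hv, hker⟩ := Matrix.exists_mulVec_eq_zero_iff.mpr hch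
    refine ⟨μ₀, hμ, by linarith, fun η μ' hη => Or.inr ⟨c, v, hv, ?_⟩⟩
    exact near_of_eigen hv (stub_sojourn N U μ₀ μ' (halfCorner s c) (halfSides s c) v hker) hη

/-! ## The composition (PROVED, no `sorry`): the stubs imply the crux, by name -/

/-- `NegativeCellsDilute` from exactly `reverseWegnerSojourn` (= stubs 1a–1c), `stub_reverseWegnerCount`,
`stub_pinnedStripLaw` — pure logic (planner's composition, unchanged): the transfer's witness and pin pass through;
at `(ε, k, S)` the transfer's `η, δ` serve clause (a) because the defect event of a window box forces a sojourn
(`2 ≤ b₀ 2^j ≤ s_i ≤ N`, `μ₀ ≤ −edge`) and such events are dominated by the strip statistic (stub 2 with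
`E := (∃ f, IsSignDefect U (m_f) j s)`), which (a⁺) bounds by `δ_j`. -/
theorem NegativeCellsDilute_of : NegativeCellsDilute := by
  have h₁ := reverseWegnerSojourn
  have h₂ := stub_reverseWegnerCount
  have h₃ := stub_pinnedStripLaw
  intro Nf hNf
  obtain ⟨reg, hms, has, M₀, hM₀, b₀, hb₀, ℓ, hℓ, hm⟩ := h₃ Nf hNf
  refine ⟨reg, hms, has, M₀, hM₀, b₀, hb₀, ℓ, hℓ, fun m hmpos => ?_⟩
  obtain ⟨R, hR, hA, hB⟩ := hm m hmpos
  refine ⟨R, hR, fun ε hε => ?_, hB⟩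
  filter_upwards [hA ε hε] with k hk
  intro S hS
  dsimp only
  obtain ⟨η, hη, δ, -, hδε, hbox⟩ := hk S hS
  refine ⟨δ, hδε, fun j hj s hs => ?_⟩
  have hs2 : ∀ i, 2 ≤ s i := fun i =>
    le_trans hb₀ (le_trans (Nat.le_mul_of_pos_right _ (Nat.two_pow_pos j)) (hs i).1)
  have hsN : ∀ i, s i ≤ 2 * S + 1 := fun i => (hs i).2.2.1
  refine le_trans (h₂ (2 * S + 1) (reg.β k) Nf (fun f => reg.mcrit k + reg.a k * m f / reg.Zm k) s η hη
    (fun U => ∃ f, IsSignDefect U (reg.mcrit k + reg.a k * m f / reg.Zm k) j s) ?_) (hbox j hj s hs)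
  rintro U ⟨f, hf⟩
  obtain ⟨μ₀, hμ, hedge, hsoj⟩ := h₁ (2 * S + 1) U _ j s hs2 hsN hf
  exact ⟨f, μ₀, hμ, hedge, fun μ' hμ' => hsoj η μ' hμ'⟩

end Summit.QuantumFields.QCD.Cruxes.NegativeCellsDilute.MassWegnerCellIndex

end
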